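import Literature.NumberTheory.LFunctions.WeilGroundEnergyParitySplit
import Literature.NumberTheory.LFunctions.WeilWindowSimpleEven
import Literature.NumberTheory.LFunctions.WeilFinitePrimeQuadratic
import Literature.NumberTheory.LFunctions.RiemannSiegelStirling
import HarnessLib

/-!
# RH-FREE (Thms 1, 3, 7, 8, Cor 9, Lemmas 5–6, Table 1) / RH-CONDITIONAL (Thm 2, Prop 4) — «nothing here bears on the truth of RH»
# The window profile `λ*(L)` of Weil's quadratic form: certified two-sided bounds at `L = 0.8` (Chuk 2026, triage-typing)

TRIAGE-TYPING of a 2026 preprint, AS PRINTED, with a status note and NO endorsement (RH literature-typing tranche 1,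
director-rh 2026-08-26; D-0088(4)). Source, read in full (held text `paper:arxiv-2608.24827`, 9 printed pages):

> M. Chuk, *Weil positivity in compact windows: certified two-sided bounds and a Landau–Widom decay law*,
> arXiv:2608.24827v1 [math.NT], 25 Aug 2026 [bib: `Chuk2026WeilWindows`].

STATUS: PREPRINT (v1), unrefereed; the lower bounds (Thm 1, Thm 8, Cor 9) are COMPUTER-ASSISTED certificates («50-digit
arithmetic … verified Cholesky residual [Rump] … remainder below 10⁻⁵⁰», §3), the upper bounds (Table 1, Thm 8) are
interval-arithmetic Rayleigh quotients; none of the certificates is reproduced or checked here. Every unproved printed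
result below is a NAMED FACT `def … : Prop` (D-0014); what is proved here is proved from the tree (Lemma 5 from the tree's
second-order Stirling bound; the threshold clause of Thm 3; the inequality (6) of Thm 7; the corollaries Thm 1 / Cor 9 /
positivity / simple-even of Thm 8).

## Dictionary (the paper's normalisation IS the tree's — cite, never restate)

* «`f̂(r) = ∫ f(u) e^{iru} du`», «normalization of [Bombieri 2000]», `Q(f) = Σ_ρ ĝ((ρ − ½)/i)`, `g = f ⋆ f̃` (§2, (5)) —
  the tree's `weilQuadratic f = weilFunctional (f ⋆ f̃)` of `WeilExplicit.lean` (same Bombieri normalisation; `F(t) = f̂(t)`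
  is `weilMellin f (1/2 + it)`, `F(i/2) = weilMellin f 0`).
* The geometric side (2)–(3): `Q(f) = 2F(i/2)² + (1/2π)∫|F(t)|² Ψ_L(t) dt`,
  `Ψ_L(t) = Re ψ(¼ + it/2) − log π − Σ_{log n < 2L} 2Λ(n) n^{-1/2} cos(t log n)` — the tree's finite-prime analytic form
  `weilFinitePrimeQuadratic N` / weight `weilFinitePrimeWeight N t = Re ψ(¼ + it/2) − weilPrimeRipple N t`
  (`WeilFinitePrimeQuadratic.lean`, `weilQuadratic_eq_weilFinitePrimeQuadratic`) at the cut-off `N = ⌈e^{2L}⌉ − 1`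
  (`{n : log n < 2L} = {n ≤ N}`); the prime comb `P_L` of Lemma 6 is `weilPrimeRipple N`, its mass `A_L = P_L(0)`.
* «`λ*(L) = inf Q(f)/‖f‖₂²` over `f` even, real, `supp f ⊂ [−L, L]`» ((1)); «`λ₁^even, λ₂^even`» = «the first two min–max
  values of `Q/‖f‖₂²` over real even `f`», «`λ₁^odd`» (Thm 8) — the tree's sector ground energies
  `weilEvenGroundEnergy L = ε_ev(L)`, `weilOddGroundEnergy L = ε_od(L)` (`WeilGroundEnergyParitySplit.lean`,
  `WeilOddGroundState.lean`) and `weilGroundEnergy L = ε(L) = min(ε_ev, ε_od)` (`weilGroundEnergy_eq_min_even_odd`).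
  ENCODING NOTE, for the referee: (a) the tree's spheres consist of SMOOTH (`IsWeilTest`) complex-valued test functions
  with `tsupport ⊆ [−L, L]`; the paper's class is «real even `f ∈ L²(ℝ)` with `supp f ⊆ [−L, L]`» (Thm 1) and its §4 prints
  the complexification «for complex `f` one has `Q(f) = Q(Re f) + Q(Im f)`» and the parity split «`Q(f) = Q(f_e) + Q(f_o)`».
  Printed LOWER bounds are therefore stated below for the tree's (smaller, smooth) spheres — a special case of the print;
  printed UPPER bounds (`λ ≤ U`, from explicit non-smooth trial functions: Legendre modes, sine modes, `F⁻¹(B·h)`) are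
  stated for the tree's smooth infima `ε_ev`, `ε_od`, i.e. through the identification «infimum over the `L²` form domain =
  infimum over the smooth core» (Bombieri 2000 §4 Thm 3; Yoshida 1992 §3), which the paper uses tacitly and which is NOT
  re-proved here — `-- TODO(general form)`. (b) «`λ₂^even ≥ c`» is encoded, as in the tree's `WeilWindowSimpleEven`, by a
  witness direction `φ` with `c‖g‖² ≤ Re Q(g)` for every even test `g ⊥ φ` of the window (Courant–Fischer).
* Relation to the tree (for the reader; no endorsement either way): the paper's «classical record … `2L ≤ log 2`» is the
  tree's `weilPositivityOn_of_le_log_two_half` (Yoshida); the tree itself holds kernel theorems `weilPositivityOn_59_100`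
  (Literature) and, Summits-side (not importable here), `WeilPositivityOn (83/100)`, `WeilPositivityOn (4023/5000)`,
  `0 ≤ ε_ev(4023/5000)`, `2.1·10⁻¹⁶ ≤ ε_od(4023/5000)` (`GroundBarta…` files) — windows `≥ 0.8`.

## What is here (printed item → declaration → status)

* (2)–(3) → `weilWindowCutoff`, `weilWindowSymbol` (Ψ_L), `weilCombMass` (A_L), `weilCombThreshold` (T₁),
  `weilEnvelopeLevel` (β*) — DEFINITIONS over the tree's objects; `weilQuadratic_re_eq_of_tsupport_subset_window` ((2) for
  smooth `f` of the window) — PROVED (it is the tree's identity).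
* Lemma 5 («for `t ≥ 15/4`, `Re ψ(¼ + it/2) − log π ≥ log(t/2π) − 1/t`») → `Chuk2026_lemma5` — PROVED (from the tree's
  second-order Stirling bound `abs_re_digamma_sub_log_norm_add_re_le`: the deficit is `≤ (0.51…)/t`).
* Lemma 6, first half («`P_L(t) ≤ A_L`, equality at `t = 0`») → `weilPrimeRipple_le_weilPrimeRipple_zero` — PROVED; second
  half («`sup_t P_L = A_L` approached at arbitrarily large `t`», Weyl/Kronecker) and Thm 3's «`A_L = (4 + o(1))e^L` by the
  prime number theorem» → `Chuk2026_thm3` — NAMED FACT (RH-FREE); Thm 3's «`β* > 0` forces `T♯ > T₁ = 2πe^{A_L}`» →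
  `weilCombThreshold_lt_of_weilEnvelopeLevel_pos` — PROVED (one line of real analysis).
* Thm 8 (the five certified numbers at `L = 0.8`: `8.9·10⁻¹⁸ ≤ λ₁^even ≤ 2.523·10⁻¹⁶`, `λ₂^even ≥ 2.085·10⁻¹²`,
  `8.206·10⁻¹⁵ ≤ λ₁^odd ≤ 2.347·10⁻¹⁴`) → `Chuk2026_thm8` — NAMED FACT (RH-FREE, computer-assisted); PROVED FROM IT:
  Thm 1 (`Chuk2026_thm8.thm1`), Cor 9 (`Chuk2026_thm8.cor9`), `Chuk2026_thm8.weilPositivityOn` (`WeilPositivityOn (4/5)`),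
  `Chuk2026_thm8.weilGroundEnergy_ge` (`8.9·10⁻¹⁸ ≤ ε(4/5)`), `Chuk2026_thm8.weilWindowSimpleEven` (the window ground state
  at `a = 4/5` is simple and even in the sense of `WeilWindowSimpleEven (4/5)`, gap `δ = 8.206·10⁻¹⁵ − 2.523·10⁻¹⁶`).
* Table 1 (twelve certified upper bounds `λ*(L) ≤ U(L)`, `L = 0.5 … 2.0`) → `chuk2026Table1` (DATA) and `Chuk2026_table1`
  — NAMED FACT (RH-FREE, interval arithmetic).
* Thm 2 («Assume RH. There is `L₀` such that `λ*(L) ≤ exp(−L e^L)` for all `L ≥ L₀`») → `Chuk2026_thm2` — NAMED FACT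
  (RH-CONDITIONAL, i.e. an implication `RiemannHypothesis → …`). KERNEL STATUS (2026-08-27): IMPLIED UNCONDITIONALLY by
  the Summits-side theorem `Summit.RiemannHypothesis.RiemannHypothesis.Theorems.PolarPerronFrobenius.weilEvenGroundEnergy_le_exp_neg_mul_exp`
  (`GroundBartaPolarPerronFrobeniusThetaQuasimode.lean`, the RH-free theta quasimode law: for every `c < π`,
  `ε_ev(a) ≤ exp(−c e^{2a})` for all large `a`) together with `L e^L ≤ e^{2L}`; the 12-line derivation
  (`Chuk2026_thm2_unconditional`, `Chuk2026_thm2_holds : Chuk2026_thm2`, kernel-checked) cannot be placed in this file — a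
  Literature module may not import a Summits module — and is attached as evidence to ledger item
  `stmt-RiemannHypothesis-18390` for a Summits-side landing (promote-candidate event 11384276). The printed RH-conditional
  rate `exp(−L e^L)` is thus weaker than what the tree proves without RH.
* Prop 4 («Assume RH. For every `L > 0` there is `c_L > 0` such that `Q(f) ≥ c_L‖f‖₂²` for all admissible `f` supported in
  `[−L, L]`»; printed with a proof SKETCH only — Beurling sampling) → `Chuk2026_prop4` — NAMED FACT (RH-CONDITIONAL).
* Thm 7 (one-stroke reduction), the inequality (6) `Q(f) ≥ R(f)` → `Chuk2026_thm7` (even window tests, integral folded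
  onto `[0, T♯]`) and `weilQuadratic_re_ge_oneStroke` (every window test, symmetric integral) — PROVED (§7 at the end of
  this file: eq. (2), Lemma 5, Parseval); Thm 7's Legendre-block bookkeeping (`β*I + 2ppᵀ + C`, `min(λ₀, β* − ε_D) − ε_B`)
  and Conjecture 10 (Landau–Widom law `−ln λ* ~ 2π² N(T*)/ln N(T*)`) are NOT typed (numerical-analysis prose about a
  specific basis; a conjecture is not literature).

Nothing in this file is, or is worded as, progress toward RH: lower bounds at a fixed window are «a finite fragment of RH»
in the paper's words (p. 2) and the criterion `∀ L, λ*(L) ≥ 0` IS RH (`riemannHypothesis_iff_forall_weilPositivityOn`).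
-/

noncomputable section

open Complex Filter Set MeasureTheory
open scoped Real Topology ComplexConjugate ArithmeticFunction.vonMangoldt

namespace Literature.NumberTheory.LFunctions

open Literature.Analysis.SpecialFunctions

/-! ## §2 The geometric side on a window `[-L, L]` (eqs. (2)–(3)) -/

/-- The frequency cut-off of the window `[-L, L]`: the prime powers on the geometric side (2)–(3) are those with
`log n < 2L`, i.e. `n < e^{2L}`, i.e. `1 ≤ n ≤ ⌈e^{2L}⌉ − 1` (`le_weilWindowCutoff_iff`).
[cite: Chuk2026WeilWindows, §1 eq. (3) («Only prime powers with log n < 2L contribute»)] -/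
def weilWindowCutoff (L : ℝ) : ℕ := ⌈Real.exp (2 * L)⌉₊ - 1

/-- `{n ≥ 1 : n ≤ ⌈e^{2L}⌉ − 1} = {n ≥ 1 : log n < 2L}`. [cite: Chuk2026WeilWindows, §1 eq. (3)] -/
theorem le_weilWindowCutoff_iff {L : ℝ} {n : ℕ} (hn : 1 ≤ n) :
    n ≤ weilWindowCutoff L ↔ Real.log n < 2 * L := by
  have hn0 : (0 : ℝ) < n := by exact_mod_cast hn
  have hceil : 1 ≤ ⌈Real.exp (2 * L)⌉₊ := Nat.one_le_iff_ne_zero.2 (Nat.ceil_pos.2 (Real.exp_pos _)).ne'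
  rw [weilWindowCutoff, Real.log_lt_iff_lt_exp hn0]
  constructor
  · intro h
    have h' : n < ⌈Real.exp (2 * L)⌉₊ := by omega
    exact Nat.lt_ceil.1 h'
  · intro h
    have : n < ⌈Real.exp (2 * L)⌉₊ := Nat.lt_ceil.2 h
    omega

/-- The window is inside the tree's finite-prime cone: `L ≤ log(N + 1)/2` for `N = weilWindowCutoff L`.
[cite: Chuk2026WeilWindows, §1 eq. (3)] -/
theorem le_log_weilWindowCutoff_succ_half (L : ℝ) : L ≤ Real.log ((weilWindowCutoff L : ℝ) + 1) / 2 := by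
  have hceil : 1 ≤ ⌈Real.exp (2 * L)⌉₊ := Nat.one_le_iff_ne_zero.2 (Nat.ceil_pos.2 (Real.exp_pos _)).ne'
  have h1 : ((weilWindowCutoff L : ℝ) + 1) = ⌈Real.exp (2 * L)⌉₊ := by
    rw [weilWindowCutoff, Nat.cast_sub hceil]
    push_cast
    ring
  have h2 : Real.exp (2 * L) ≤ (weilWindowCutoff L : ℝ) + 1 := by rw [h1]; exact Nat.le_ceil _
  have h3 : 2 * L ≤ Real.log ((weilWindowCutoff L : ℝ) + 1) := by
    rw [← Real.log_exp (2 * L)]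
    exact Real.log_le_log (Real.exp_pos _) h2
  linarith

/-- **The Weil symbol `Ψ_L` of eq. (3)**: `Ψ_L(t) = Re ψ(¼ + it/2) − log π − Σ_{log n < 2L} 2Λ(n) n^{-1/2} cos(t log n)`,
i.e. the tree's finite-prime weight `weilFinitePrimeWeight N t` at `N = weilWindowCutoff L`, minus `log π`.
[cite: Chuk2026WeilWindows, §1 eq. (3)] -/
def weilWindowSymbol (L t : ℝ) : ℝ := weilFinitePrimeWeight (weilWindowCutoff L) t - Real.log π

/-- **The mass of the prime comb** `A_L = Σ_{log n < 2L} 2Λ(n)/√n` (p. 2, before Thm 1) — the value at `t = 0` of the comb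
`P_L = weilPrimeRipple (weilWindowCutoff L)` of Lemma 6. [cite: Chuk2026WeilWindows, §1 (definition of A_L) and Lemma 6] -/
def weilCombMass (L : ℝ) : ℝ := weilPrimeRipple (weilWindowCutoff L) 0

/-- `A_L = Σ_{n ≤ N} (Λ(n)/√n)·2` written out (`cos 0 = 1`). [cite: Chuk2026WeilWindows, §1 (definition of A_L)] -/
theorem weilCombMass_eq (L : ℝ) :
    weilCombMass L = ∑ n ∈ Finset.range (weilWindowCutoff L + 1), (Λ n : ℝ) / Real.sqrt n * 2 := by
  simp [weilCombMass, weilPrimeRipple]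

/-- **The resolution threshold `T₁(L) = 2π e^{A_L}`** of Thm 3 / Thm 7. [cite: Chuk2026WeilWindows, Thm 3 and Thm 7] -/
def weilCombThreshold (L : ℝ) : ℝ := 2 * π * Real.exp (weilCombMass L)

/-- **The envelope level `β* = log(T♯/2π) − 1/T♯ − A_L`** of Thm 7. [cite: Chuk2026WeilWindows, Thm 7] -/
def weilEnvelopeLevel (L T : ℝ) : ℝ := Real.log (T / (2 * π)) - 1 / T - weilCombMass L

/-- **Eq. (2) for smooth test functions of the window** (the tree's identity `Q = E_N`,
`weilQuadratic_re_eq_weilFinitePrimeQuadratic`, at the window cut-off): for a test function `g` with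
`tsupport g ⊆ [−L, L]`,
`Re Q(g) = 2 Re(ĝ(0) conj ĝ(1)) − (log π)‖g‖₂² + (1/2π) ∫ |ĝ(½+it)|² (Re ψ(¼+it/2) − P_L(t)) dt`, which is (2) with
`Ψ_L = weilWindowSymbol L` after `(1/2π)∫|ĝ|² = ‖g‖₂²`; for real even `g`, `ĝ(0) = ĝ(1) = F(i/2) ∈ ℝ`.
[cite: Chuk2026WeilWindows, §1 eq. (2)–(3)] -/
theorem weilQuadratic_re_eq_of_tsupport_subset_window {g : ℝ → ℂ} (hg : IsWeilTest g) {L : ℝ}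
    (hsupp : tsupport g ⊆ Icc (-L) L) :
    (weilQuadratic g).re = weilFinitePrimeQuadratic (weilWindowCutoff L) g := by
  have hL := le_log_weilWindowCutoff_succ_half L
  exact weilQuadratic_re_eq_weilFinitePrimeQuadratic hg _ (hsupp.trans (Icc_subset_Icc (by linarith) hL))

/-! ## §3 Lemma 5 (crude envelope) — PROVED -/

/-- **Lemma 5 (crude envelope), proved**: «For all `t ≥ 15/4`, `Re ψ(¼ + it/2) − log π ≥ log(t/2π) − 1/t`», i.e.
`Re ψ(¼ + it/2) ≥ log(t/2) − 1/t`. The paper argues from Binet's second formula; here it follows from the tree's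
second-order Stirling bound `|Re ψ(w) − log‖w‖ + Re(1/2w)| ≤ 1/(6|Im w|³) + π/(12 (Im w)²)` at `w = ¼ + it/2`:
`log‖w‖ ≥ log(t/2)`, `Re(1/2w) = 2/(1 + 4t²) ≤ 1/(3t)`, `4/(3t³) ≤ 1/(3t)`, `π/(3t²) ≤ 1/(3t)` for `t ≥ 15/4`. (Hence
`Ψ_L(t) ≥ log(t/2π) − 1/t − A_L`, the second display of the lemma: `weilWindowSymbol_ge`.)
[cite: Chuk2026WeilWindows, Lemma 5] -/
theorem Chuk2026_lemma5 {t : ℝ} (ht : 15 / 4 ≤ t) :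
    Real.log (t / (2 * π)) - 1 / t ≤ reDigammaQuarter t - Real.log π := by
  have ht0 : 0 < t := by linarith
  have hπ := Real.pi_pos
  have hπ3 : π < 3.15 := Real.pi_lt_d2
  set w : ℂ := 1 / 4 + (t : ℂ) / 2 * I with hw
  have hre : w.re = 1 / 4 := by simp [hw]
  have him : w.im = t / 2 := by simp [hw]
  have hb := Literature.NumberTheory.LFunctions.Complex.abs_re_digamma_sub_log_norm_add_re_le (w := w)
    (by rw [hre]; norm_num) (by rw [him]; positivity)
  rw [abs_le] at hb
  have hR : reDigammaQuarter t = (Complex.digamma w).re := rfl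
  -- `‖w‖ ≥ t/2`
  have hnorm : t / 2 ≤ ‖w‖ := by
    have h := Complex.abs_im_le_norm w
    rwa [him, abs_of_pos (by positivity)] at h
  have hlog : Real.log (t / 2) ≤ Real.log ‖w‖ := Real.log_le_log (by positivity) hnorm
  -- `Re (1/(2w)) = 2/(1 + 4t²)`
  have h2w : 2 * w = ⟨1 / 2, t⟩ := by
    apply Complex.ext <;> simp [hw] <;> ring
  have hinv : (1 / (2 * w)).re = 2 / (1 + 4 * t ^ 2) := by
    rw [one_div, h2w, Complex.inv_re, Complex.normSq_mk]
    field_simp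
    ring
  -- the three small terms
  have h1 : 2 / (1 + 4 * t ^ 2) ≤ 1 / (3 * t) := by
    rw [div_le_div_iff₀ (by positivity) (by positivity)]
    nlinarith
  have h2 : 1 / (6 * |w.im| ^ 3) ≤ 1 / (3 * t) := by
    rw [him, abs_of_pos (by positivity), div_le_div_iff₀ (by positivity) (by positivity)]
    nlinarith
  have h3 : π / (12 * w.im ^ 2) ≤ 1 / (3 * t) := by
    rw [him, div_le_div_iff₀ (by positivity) (by positivity)]
    nlinarith
  have hsum : 2 / (1 + 4 * t ^ 2) + (1 / (6 * |w.im| ^ 3) + π / (12 * w.im ^ 2)) ≤ 1 / t := by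
    have : 1 / (3 * t) + (1 / (3 * t) + 1 / (3 * t)) = 1 / t := by field_simp; ring
    linarith
  have hsplit : Real.log (t / (2 * π)) = Real.log (t / 2) - Real.log π := by
    rw [show t / (2 * π) = (t / 2) / π by ring, Real.log_div (by positivity) hπ.ne']
  rw [hsplit, hR]
  linarith [hb.1]

/-! ## §3 Lemma 6 (first half) and the threshold clause of Thm 3 — PROVED; the rest of Lemma 6 / Thm 3 — NAMED FACT -/

/-- **Lemma 6, first half**: `P_L(t) ≤ A_L` for every `t` («trivial, with equality at `t = 0`»): each term
`(Λ(n)/√n)·2cos(t log n)` is at most `(Λ(n)/√n)·2`. [cite: Chuk2026WeilWindows, Lemma 6] -/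
theorem weilPrimeRipple_le_weilPrimeRipple_zero (N : ℕ) (t : ℝ) : weilPrimeRipple N t ≤ weilPrimeRipple N 0 := by
  unfold weilPrimeRipple
  refine Finset.sum_le_sum fun n _ ↦ ?_
  have hΛ : 0 ≤ (Λ n : ℝ) / Real.sqrt n := div_nonneg ArithmeticFunction.vonMangoldt_nonneg (Real.sqrt_nonneg _)
  have hcos : Real.cos (t * Real.log n) ≤ 1 := Real.cos_le_one _
  simp only [zero_mul, Real.cos_zero, mul_one]
  nlinarith

/-- `Ψ_L(t) ≥ log(t/2π) − 1/t − A_L` for `t ≥ 15/4` — the second display of Lemma 5 (Lemma 5 and `P_L ≤ A_L`).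
[cite: Chuk2026WeilWindows, Lemma 5] -/
theorem weilWindowSymbol_ge {L t : ℝ} (ht : 15 / 4 ≤ t) :
    Real.log (t / (2 * π)) - 1 / t - weilCombMass L ≤ weilWindowSymbol L t := by
  have h5 := Chuk2026_lemma5 ht
  have h6 := weilPrimeRipple_le_weilPrimeRipple_zero (weilWindowCutoff L) t
  unfold weilWindowSymbol weilFinitePrimeWeight weilCombMass
  linarith

/-- **Thm 3 (Barrier), threshold clause, proved**: «`β* > 0` forces `T♯ > T₁ = 2πe^{A_L}`» — if
`log(T/2π) − 1/T − A_L > 0` and `T > 0` then `2π e^{A_L} < T`. [cite: Chuk2026WeilWindows, Thm 3 and §7] -/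
theorem weilCombThreshold_lt_of_weilEnvelopeLevel_pos {L T : ℝ} (hT : 0 < T) (hβ : 0 < weilEnvelopeLevel L T) :
    weilCombThreshold L < T := by
  unfold weilEnvelopeLevel at hβ
  unfold weilCombThreshold
  have hπ := Real.pi_pos
  have h1 : weilCombMass L < Real.log (T / (2 * π)) := by
    have : 0 < 1 / T := by positivity
    linarith
  have h2 : Real.exp (weilCombMass L) < T / (2 * π) := by
    calc Real.exp (weilCombMass L) < Real.exp (Real.log (T / (2 * π))) := Real.exp_lt_exp.2 h1
      _ = T / (2 * π) := Real.exp_log (by positivity)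
  rw [lt_div_iff₀ (by positivity)] at h2
  linarith

/-- NAMED FACT — **Thm 3 (Barrier), the two asymptotic clauses, and Lemma 6 (second half)**, AS PRINTED:
«`A_L = (4 + o(1)) e^L` as `L → ∞` by the prime number theorem» and «`sup_t` of the prime comb equals `A_L` exactly …
the supremum is approached at arbitrarily large `t` (Weyl equidistribution: `{log p}` are linearly independent over `ℚ`)»,
so that «within the class of certificates that bound the comb pointwise the threshold `T₁` cannot be lowered».
RH-FREE (PNT and Kronecker–Weyl; no zeros). The threshold clause `β* > 0 ⇒ T♯ > T₁` is the theorem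
`weilCombThreshold_lt_of_weilEnvelopeLevel_pos`; the informal «matrix size `N ≍ L T₁` grows doubly exponentially» is not a
mathematical statement and is not typed. Users take `(h : Chuk2026_thm3)`. [cite: Chuk2026WeilWindows, Thm 3 and Lemma 6] -/
def Chuk2026_thm3 : Prop :=
  Tendsto (fun L : ℝ ↦ weilCombMass L / Real.exp L) atTop (𝓝 4) ∧
  ∀ L : ℝ, ∀ ε : ℝ, 0 < ε → ∀ T : ℝ, ∃ t : ℝ, T ≤ t ∧
    weilCombMass L - ε < weilPrimeRipple (weilWindowCutoff L) t

/-! ## §4 Theorem 8 (the certified numbers at `L = 0.8`) — NAMED FACT — and its proved corollaries Thm 1, Cor 9 -/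

/-- NAMED FACT — **Thm 8 (Simple even ground state, support 1.6)**, AS PRINTED: «Let `λ₁^even, λ₂^even` be the first two
min–max values of `Q/‖f‖₂²` over real even `f` with `supp f ⊆ [−0.8, 0.8]`, and `λ₁^odd` the infimum over real odd `f`.
Then `8.9 × 10⁻¹⁸ ≤ λ₁^even ≤ 2.523 × 10⁻¹⁶`, `λ₂^even ≥ 2.085 × 10⁻¹²`, `8.206 × 10⁻¹⁵ ≤ λ₁^odd ≤ 2.347 × 10⁻¹⁴`.
The ground state is therefore simple and even.» COMPUTER-ASSISTED (even lower bound = Thm 1: Thm 7 at `T♯ = 200`,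
`β* = 0.5134…`, 200 even Legendre modes, verified Cholesky at shift `8.9·10⁻¹⁸`; odd lower bound: `T♯ = 150`, 200 odd
modes; the even gap «is a Courant–Fischer restriction test»); NOT reproduced here. Encoding (module docstring): the
sectors are the tree's `ε_ev(4/5) = weilEvenGroundEnergy (4/5)`, `ε_od(4/5) = weilOddGroundEnergy (4/5)` (smooth complex
test functions — the printed class is real `L²`; lower bounds are a special case of the print + its §4 complexification,
upper bounds go through the form-core identification, `-- TODO(general form)`); «`λ₂^even ≥ c`» is the Courant–Fischer
clause: a direction `φ` with `c ∫|g|² ≤ Re Q(g)` for every even window test `g ⊥ φ`. RH-FREE («No zeros and no RH enter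
the certificates»). Users take `(h : Chuk2026_thm8)`. [cite: Chuk2026WeilWindows, Thm 8 (with Thm 1 and §3 «The certificate at L = 0.8»)] -/
def Chuk2026_thm8 : Prop :=
  ((8.9e-18 : ℝ) ≤ weilEvenGroundEnergy (4 / 5) ∧ weilEvenGroundEnergy (4 / 5) ≤ (2.523e-16 : ℝ)) ∧
  (∃ φ : ℝ → ℂ, ∀ g : ℝ → ℂ, IsWeilTest g → tsupport g ⊆ Icc (-(4 / 5 : ℝ)) (4 / 5) → (∀ t, g (-t) = g t) →
      ∫ t, conj (φ t) * g t = 0 → (2.085e-12 : ℝ) * ∫ t, ‖g t‖ ^ 2 ≤ (weilQuadratic g).re) ∧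
  ((8.206e-15 : ℝ) ≤ weilOddGroundEnergy (4 / 5) ∧ weilOddGroundEnergy (4 / 5) ≤ (2.347e-14 : ℝ))

namespace Chuk2026_thm8

/-- **Thm 1 (Certified positivity, support 1.6) from Thm 8**: «For every real even `f ∈ L²(ℝ)` with
`supp f ⊆ [−0.8, 0.8]`, `Q(f) ≥ 8.9 × 10⁻¹⁸ ‖f‖₂²`» — here for every even test function `g` of the window (the even lower
bound of Thm 8 in homogeneous form, `weilEvenGroundEnergy_mul_le_re`). [cite: Chuk2026WeilWindows, Thm 1] -/
theorem thm1 (h : Chuk2026_thm8) {g : ℝ → ℂ} (hg : IsWeilTest g) (hsupp : tsupport g ⊆ Icc (-(4 / 5 : ℝ)) (4 / 5))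
    (hev : ∀ t, g (-t) = g t) : (8.9e-18 : ℝ) * ∫ t, ‖g t‖ ^ 2 ≤ (weilQuadratic g).re := by
  have h1 := weilEvenGroundEnergy_mul_le_re hg hsupp hev
  have hn : 0 ≤ ∫ t, ‖g t‖ ^ 2 := integral_nonneg fun _ ↦ by positivity
  nlinarith [h.1.1]

/-- The odd-sector lower bound of Thm 8 in homogeneous form: `8.206·10⁻¹⁵ ∫|g|² ≤ Re Q(g)` for odd window tests.
[cite: Chuk2026WeilWindows, Thm 8] -/
theorem odd (h : Chuk2026_thm8) {g : ℝ → ℂ} (hg : IsWeilTest g) (hsupp : tsupport g ⊆ Icc (-(4 / 5 : ℝ)) (4 / 5))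
    (hodd : ∀ t, g (-t) = -g t) : (8.206e-15 : ℝ) * ∫ t, ‖g t‖ ^ 2 ≤ (weilQuadratic g).re := by
  have h1 := weilOddGroundEnergy_mul_le_re hg hsupp hodd
  have hn : 0 ≤ ∫ t, ‖g t‖ ^ 2 := integral_nonneg fun _ ↦ by positivity
  nlinarith [h.2.2.1]

/-- **Cor 9 from Thm 8**: «For every complex `f ∈ L²(ℝ)` with `supp f ⊆ [−0.8, 0.8]`, `Q(f) ≥ 8.9 × 10⁻¹⁸ ‖f‖₂²`» — here
for every test function of the window, by the printed argument: `Q(f) = Q(f_e) + Q(f_o)` (the tree's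
`weilQuadratic_eq_evenPart_add_oddPart`), `‖f‖² = ‖f_e‖² + ‖f_o‖²`, and the two sector bounds with
`8.9·10⁻¹⁸ ≤ 8.206·10⁻¹⁵`. [cite: Chuk2026WeilWindows, Cor 9 and §4] -/
theorem cor9 (h : Chuk2026_thm8) {g : ℝ → ℂ} (hg : IsWeilTest g) (hsupp : tsupport g ⊆ Icc (-(4 / 5 : ℝ)) (4 / 5)) :
    (8.9e-18 : ℝ) * ∫ t, ‖g t‖ ^ 2 ≤ (weilQuadratic g).re := by
  set e : ℝ → ℂ := fun t ↦ (g t + g (-t)) / 2 with he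
  set o : ℝ → ℂ := fun t ↦ (g t - g (-t)) / 2 with ho
  have hes : tsupport e ⊆ Icc (-(4 / 5 : ℝ)) (4 / 5) :=
    tsupport_subset_Icc_of_symm hsupp fun s h1 h2 ↦ by simp [he, h1, h2]
  have hos : tsupport o ⊆ Icc (-(4 / 5 : ℝ)) (4 / 5) :=
    tsupport_subset_Icc_of_symm hsupp fun s h1 h2 ↦ by simp [ho, h1, h2]
  have hev : ∀ t, e (-t) = e t := fun t ↦ by simp only [he, neg_neg]; ring
  have hodd : ∀ t, o (-t) = -o t := fun t ↦ by simp only [ho, neg_neg]; ring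
  have h1 := h.thm1 hg.evenPart hes hev
  have h2 := h.odd hg.oddPart hos hodd
  have hsplit : (weilQuadratic g).re = (weilQuadratic e).re + (weilQuadratic o).re := by
    rw [weilQuadratic_eq_evenPart_add_oddPart hg, Complex.add_re]
  have hnorm : (∫ t, ‖e t‖ ^ 2) + ∫ t, ‖o t‖ ^ 2 = ∫ t, ‖g t‖ ^ 2 := integral_norm_sq_evenPart_add_oddPart hg
  have ho0 : 0 ≤ ∫ t, ‖o t‖ ^ 2 := integral_nonneg fun _ ↦ by positivity
  rw [hsplit, ← hnorm]
  nlinarith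

/-- **Weil positivity on `[−0.8, 0.8]` from Thm 8** («In particular the Weil form is positive on all autocorrelations
`g = f ⋆ f̃` with `supp g ⊆ [−1.6, 1.6]`»): `WeilPositivityOn (4/5)`. [cite: Chuk2026WeilWindows, Thm 1 and Cor 9] -/
theorem weilPositivityOn (h : Chuk2026_thm8) : WeilPositivityOn (4 / 5) := fun g hg hsupp ↦ by
  have h1 := h.cor9 hg hsupp
  have hn : 0 ≤ ∫ t, ‖g t‖ ^ 2 := integral_nonneg fun _ ↦ by positivity
  nlinarith

/-- **The enclosure's lower end for the full ground energy**: `8.9·10⁻¹⁸ ≤ ε(4/5) = min(ε_ev, ε_od)`.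
[cite: Chuk2026WeilWindows, Cor 9] -/
theorem weilGroundEnergy_ge (h : Chuk2026_thm8) : (8.9e-18 : ℝ) ≤ weilGroundEnergy (4 / 5) := by
  rw [weilGroundEnergy_eq_min_even_odd]
  refine le_min h.1.1 (le_trans ?_ h.2.2.1)
  norm_num

/-- **«The ground state is therefore simple and even» — in the tree's sense `WeilWindowSimpleEven (4/5)`**: with the
Courant–Fischer direction `φ` of Thm 8 and `δ = 8.206·10⁻¹⁵ − 2.523·10⁻¹⁶ > 0`, every normalised window test which is
odd, or even and orthogonal to `φ`, has `Re Q ≥ ε(4/5) + δ` (`ε ≤ ε_ev ≤ 2.523·10⁻¹⁶`, odd floor `8.206·10⁻¹⁵`, even-⊥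
floor `2.085·10⁻¹²`). [cite: Chuk2026WeilWindows, Thm 8 («clearance at least a factor 32 against the odd sector»)] -/
theorem weilWindowSimpleEven (h : Chuk2026_thm8) : WeilWindowSimpleEven (4 / 5) := by
  obtain ⟨⟨_, hevU⟩, ⟨φ, hφ⟩, ⟨_, _⟩⟩ := h
  have hεle : weilGroundEnergy (4 / 5) ≤ (2.523e-16 : ℝ) :=
    (weilGroundEnergy_le_weilEvenGroundEnergy _).trans hevU
  refine ⟨φ, (8.206e-15 : ℝ) - 2.523e-16, by norm_num, fun g hg hsupp hn hpar ↦ ?_⟩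
  rcases hpar with hodd | ⟨hev, horth⟩
  · have h1 := weilOddGroundEnergy_mul_le_re hg hsupp hodd
    rw [hn, mul_one] at h1
    linarith
  · have h1 := hφ g hg hsupp hev horth
    rw [hn, mul_one] at h1
    have : (8.206e-15 : ℝ) - 2.523e-16 ≤ (2.085e-12 : ℝ) - 2.523e-16 := by norm_num
    linarith

end Chuk2026_thm8

/-! ## §5 Table 1 (certified upper bounds for `λ*(L)`) — DATA + NAMED FACT -/

/-- **Table 1**, the column «`λ*(L) ≤`» as printed, rows `(L, U(L))`: «Unconditional certified upper bounds for `λ*(L)`,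
from geometric-side interval evaluation of `Q(f_L)/‖f_L‖₂²» (explicit even trial functions `f_L` in a sine basis of
`L²(−L, L)`; the columns `n` (sine modes) and `dps` (digits) are not recorded here).
[cite: Chuk2026WeilWindows, Table 1] -/
def chuk2026Table1 : List (ℝ × ℝ) :=
  [(0.5, 1.05e-6), (0.6, 1.82e-9), (0.7, 4.99e-13), (0.8, 2.27e-17), (0.9, 5.91e-23), (1.0, 8.08e-30),
   (1.1, 2.78e-38), (1.2, 9.98e-49), (1.4, 1.91e-77), (1.6, 8.61e-121), (1.8, 7.86e-186), (2.0, 3.19e-283)]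

/-- NAMED FACT — **Table 1** (twelve interval-arithmetic upper bounds): for each printed row `(L, U)`, `λ*(L) ≤ U`, with
`λ*(L)` read as the tree's even-sector ground energy `ε_ev(L)` (the trial functions are even; encoding note (a) of the
module docstring on upper bounds applies). RH-FREE, COMPUTER-ASSISTED, not reproduced here.
Users take `(h : Chuk2026_table1)`. [cite: Chuk2026WeilWindows, Table 1] -/
def Chuk2026_table1 : Prop :=
  ∀ p ∈ chuk2026Table1, weilEvenGroundEnergy p.1 ≤ p.2

/-- The row `L = 0.8` of Table 1: `ε_ev(4/5) ≤ 2.27·10⁻¹⁷` (sharper than Thm 8's Legendre-run `2.523·10⁻¹⁶`; with Thm 1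
the printed enclosure «`8.9 × 10⁻¹⁸ ≤ λ*(0.8) ≤ 2.27 × 10⁻¹⁷`, a factor 2.6»).
[cite: Chuk2026WeilWindows, Table 1 and §1 «Enclosure and barrier»] -/
theorem Chuk2026_table1.row_0_8 (h : Chuk2026_table1) : weilEvenGroundEnergy (4 / 5) ≤ (2.27e-17 : ℝ) := by
  have h1 := h (0.8, 2.27e-17) (by simp [chuk2026Table1])
  have h08 : ((0.8 : ℝ), (2.27e-17 : ℝ)).1 = 4 / 5 := by norm_num
  rw [h08] at h1
  exact h1

/-! ## §6 Theorem 2 and Proposition 4 — NAMED FACTS (RH-CONDITIONAL) -/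

/-- NAMED FACT — **Thm 2**, AS PRINTED: «Assume RH. There is an `L₀` such that for all `L ≥ L₀`, `λ*(L) ≤ exp(−L e^L)`.»
(Proof in §6: `T = 2πe^L`, `f̂₀ = B·h` with `B(r) = Π_{0<γ_j≤T}(1 − r²/γ_j²)` annihilating the zeros up to `T` and
`h = (sin(Lr/m)/(Lr/m))^m`, `m = ⌈LT/e⌉`; under RH `Q(f₀) = Σ_{γ>T} 2 f̂₀(γ)²`.) RH-CONDITIONAL: an implication from
Mathlib's `RiemannHypothesis`. `λ*(L)` is read as `ε_ev(L)` (encoding note (a) on upper bounds: the printed `f₀` is an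
`L¹ ∩ L²` function of support `[−L, L]`, not a smooth one). Users take `(h : Chuk2026_thm2)`.
KERNEL STATUS: true unconditionally — the Summits-side RH-free theta quasimode law
`PolarPerronFrobenius.weilEvenGroundEnergy_le_exp_neg_mul_exp` (`ε_ev(a) ≤ exp(−c e^{2a})` eventually, every `c < π`) and
`L e^L ≤ e^{2L}` give it without the RH hypothesis (derivation `Chuk2026_thm2_holds` kernel-checked, 2026-08-27, attached to
ledger item `stmt-RiemannHypothesis-18390`; not importable here, see the module docstring).
[cite: Chuk2026WeilWindows, Thm 2 and §6] -/
def Chuk2026_thm2 : Prop :=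
  RiemannHypothesis → ∃ L₀ : ℝ, ∀ L : ℝ, L₀ ≤ L → weilEvenGroundEnergy L ≤ Real.exp (-(L * Real.exp L))

/-- NAMED FACT — **Prop 4**, AS PRINTED: «Assume RH. For every `L > 0` there is `c_L > 0` such that `Q(f) ≥ c_L ‖f‖₂²`
for all admissible `f` supported in `[−L, L]`; in particular `λ*(L) > 0`.» («admissible» = even real test functions of
compact support, §1; printed with a proof SKETCH only: Paley–Wiener, gaps `γ_{n+1} − γ_n → 0`, Beurling's sampling theorem
for a `π/(4L)`-separated subset of `{±γ}` of lower density `> L/π`; «No effective `c_L` comes out of the argument».)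
Stated for the tree's smooth real-valued even test functions of the window (a special case of the print). RH-CONDITIONAL.
Users take `(h : Chuk2026_prop4)`. [cite: Chuk2026WeilWindows, Prop 4] -/
def Chuk2026_prop4 : Prop :=
  RiemannHypothesis → ∀ L : ℝ, 0 < L → ∃ c : ℝ, 0 < c ∧
    ∀ g : ℝ → ℂ, IsWeilTest g → tsupport g ⊆ Icc (-L) L → (∀ t, g (-t) = g t) → (∀ t, (g t).im = 0) →
      c * ∫ t, ‖g t‖ ^ 2 ≤ (weilQuadratic g).re


/-! ## §7 Theorem 7 (one-stroke reduction), the inequality `Q(f) ≥ R(f)` — PROVED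

Appended (proof-only; no new definitions, no new named facts). The printed Thm 7 has two parts: the inequality (6)
`Q(f) ≥ R(f) := 2F(i/2)² + (1/π)∫₀^{T♯} (Ψ_L(t) − β*)|F(t)|² dt + β*‖f‖₂²` for real even `f` of the window whenever
`β* > 0`, proved here from eq. (2) (`weilQuadratic_re_eq_of_tsupport_subset_window`), Lemma 5 (`weilWindowSymbol_ge`)
and Parseval (`integral_norm_sq_weilMellin_half_line`), exactly as in the printed proof («Split `∫₀^∞ = ∫₀^{T♯} + ∫_{T♯}^∞`
in (2) … On `[T♯, ∞)` Lemma 5 yields `Ψ_L ≥ β*` … Parseval»); and the Legendre-block bookkeeping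
(`β*I + 2ppᵀ + C`, `min(λ₀, β* − ε_D) − ε_B`), which is numerical-analysis prose about a specific basis and is not typed. -/

/-- `A_L ≥ 0`. [cite: Chuk2026WeilWindows, §1 (definition of A_L)] -/
theorem weilCombMass_nonneg (L : ℝ) : 0 ≤ weilCombMass L := by
  rw [weilCombMass_eq]
  exact Finset.sum_nonneg fun n _ ↦
    mul_nonneg (div_nonneg ArithmeticFunction.vonMangoldt_nonneg (Real.sqrt_nonneg _)) (by norm_num)

/-- `2π ≤ T₁(L)`; in particular `β* > 0` puts `T♯` beyond `2π > 15/4`, inside the range of Lemma 5.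
[cite: Chuk2026WeilWindows, Thm 3 and Lemma 5] -/
theorem two_pi_le_weilCombThreshold (L : ℝ) : 2 * π ≤ weilCombThreshold L := by
  unfold weilCombThreshold
  have h1 : 1 ≤ Real.exp (weilCombMass L) := Real.one_le_exp (weilCombMass_nonneg L)
  nlinarith [Real.pi_pos]

/-- The prime comb is even in `t`. [cite: Chuk2026WeilWindows, Lemma 6] -/
theorem weilPrimeRipple_abs (N : ℕ) (t : ℝ) : weilPrimeRipple N |t| = weilPrimeRipple N t := by
  rcases le_or_gt 0 t with ht | ht
  · rw [abs_of_nonneg ht]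
  · rw [abs_of_neg ht]
    unfold weilPrimeRipple
    refine Finset.sum_congr rfl fun n _ ↦ ?_
    rw [show -t * Real.log n = -(t * Real.log n) by ring, Real.cos_neg]

/-- The Weil symbol is even in `t`. [cite: Chuk2026WeilWindows, §1 eq. (3)] -/
theorem weilWindowSymbol_abs (L t : ℝ) : weilWindowSymbol L |t| = weilWindowSymbol L t := by
  unfold weilWindowSymbol weilFinitePrimeWeight
  rw [weilPrimeRipple_abs]
  rcases le_or_gt 0 t with ht | ht
  · rw [abs_of_nonneg ht]
  · rw [abs_of_neg ht, reDigammaQuarter_even]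

/-- **«On `[T♯, ∞)`, Lemma 5 yields `Ψ_L(t) ≥ β*`»**: for `T ≥ 15/4` and `|t| ≥ T`,
`β*(L, T) = log(T/2π) − 1/T − A_L ≤ log(|t|/2π) − 1/|t| − A_L ≤ Ψ_L(t)`. [cite: Chuk2026WeilWindows, Thm 7 (proof)] -/
theorem weilEnvelopeLevel_le_weilWindowSymbol {L T t : ℝ} (hT : 15 / 4 ≤ T) (ht : T ≤ |t|) :
    weilEnvelopeLevel L T ≤ weilWindowSymbol L t := by
  have hT0 : 0 < T := by linarith
  have ht0 : 0 < |t| := lt_of_lt_of_le hT0 ht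
  have hπ := Real.pi_pos
  have h1 := weilWindowSymbol_ge (L := L) (le_trans hT ht)
  rw [weilWindowSymbol_abs] at h1
  have h2 : Real.log (T / (2 * π)) ≤ Real.log (|t| / (2 * π)) :=
    Real.log_le_log (by positivity) (by gcongr)
  have h3 : 1 / |t| ≤ 1 / T := one_div_le_one_div_of_le hT0 ht
  unfold weilEnvelopeLevel
  linarith

/-- **Thm 7, inequality (6), symmetric form valid for every test function of the window.** For `g` with
`tsupport g ⊆ [−L, L]`, `T > 0` and `β* = β*(L, T) > 0`:
`2 Re(ĝ(0) conj ĝ(1)) + (1/2π) ∫_{−T}^{T} (Ψ_L(t) − β*) |ĝ(½+it)|² dt + β* ‖g‖₂² ≤ Re Q(g)`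
(eq. (2), then on `|t| ≥ T` the envelope `Ψ_L ≥ β*` of Lemma 5 — applicable since `β* > 0` forces `T > T₁ ≥ 2π > 15/4` —
and Parseval `∫|ĝ(½+it)|² = 2π‖g‖₂²`). [cite: Chuk2026WeilWindows, Thm 7 (eq. (6) and its proof)] -/
theorem weilQuadratic_re_ge_oneStroke {g : ℝ → ℂ} (hg : IsWeilTest g) {L T : ℝ}
    (hsupp : tsupport g ⊆ Icc (-L) L) (hT : 0 < T) (hβ : 0 < weilEnvelopeLevel L T) :
    2 * (weilMellin g 0 * conj (weilMellin g 1)).re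
      + 1 / (2 * π) * (∫ t in (-T)..T,
          (weilWindowSymbol L t - weilEnvelopeLevel L T) * ‖weilMellin g (1 / 2 + t * I)‖ ^ 2)
      + weilEnvelopeLevel L T * weilNorm2Sq g ≤ (weilQuadratic g).re := by
  have hπ := Real.pi_pos
  -- `T ≥ 15/4`
  have hT1 : 15 / 4 ≤ T := by
    have h := weilCombThreshold_lt_of_weilEnvelopeLevel_pos hT hβ
    have h2 := two_pi_le_weilCombThreshold L
    have h3 : (3 : ℝ) < π := Real.pi_gt_three
    linarith
  -- names
  set N : ℕ := weilWindowCutoff L with hN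
  set β : ℝ := weilEnvelopeLevel L T with hβdef
  set n2 : ℝ := weilNorm2Sq g with hn2
  set H : ℝ → ℂ := fun t ↦ weilMellin g (1 / 2 + t * I) with hH
  set f1 : ℝ → ℝ := fun t ↦ (weilWindowSymbol L t - β) * ‖H t‖ ^ 2 with hf1
  -- eq. (2)
  have hE : (weilQuadratic g).re = 2 * (weilMellin g 0 * conj (weilMellin g 1)).re - Real.log π * n2
      + 1 / (2 * π) * ∫ t : ℝ, ‖H t‖ ^ 2 * weilFinitePrimeWeight N t := by
    rw [weilQuadratic_re_eq_of_tsupport_subset_window hg hsupp]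
    rfl
  -- integrability
  have hint_H : Integrable fun t : ℝ ↦ ‖H t‖ ^ 2 := integrable_norm_sq_weilMellin_half_line hg
  have hint_w : Integrable fun t : ℝ ↦ ‖H t‖ ^ 2 * weilFinitePrimeWeight N t :=
    integrable_norm_sq_weilMellin_mul_weilFinitePrimeWeight hg N
  have hint_f1 : Integrable f1 := by
    have h := (hint_w.sub (hint_H.mul_const (Real.log π + β)))
    refine h.congr (Eventually.of_forall fun t ↦ ?_)
    simp only [Pi.sub_apply, hf1, weilWindowSymbol, hN]
    ring
  have hint_ind : Integrable ((Icc (-T) T).indicator f1) := hint_f1.indicator measurableSet_Icc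
  have hint_f2 : Integrable fun t : ℝ ↦ (β + Real.log π) * ‖H t‖ ^ 2 := hint_H.const_mul _
  -- pointwise: `1_{[-T,T]} f1 + (β + log π)|H|² ≤ |H|² w_N`
  have hpt : ∀ t : ℝ, (Icc (-T) T).indicator f1 t + (β + Real.log π) * ‖H t‖ ^ 2 ≤
      ‖H t‖ ^ 2 * weilFinitePrimeWeight N t := by
    intro t
    by_cases ht : t ∈ Icc (-T) T
    · rw [indicator_of_mem ht, hf1]
      simp only [weilWindowSymbol, hN]
      nlinarith [sq_nonneg ‖H t‖]
    · rw [indicator_of_notMem ht, zero_add]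
      have hTt : T ≤ |t| := by
        simp only [mem_Icc, not_and_or, not_le] at ht
        rcases ht with h | h
        · rw [abs_of_neg (by linarith)]; linarith
        · exact h.le.trans (le_abs_self t)
      have hlev := weilEnvelopeLevel_le_weilWindowSymbol (L := L) hT1 hTt
      have hw : β + Real.log π ≤ weilFinitePrimeWeight N t := by
        simp only [weilWindowSymbol, hN, hβdef] at hlev ⊢
        linarith
      rw [mul_comm]
      exact mul_le_mul_of_nonneg_left hw (sq_nonneg _)
  have hint_rhs : Integrable fun t : ℝ ↦ (Icc (-T) T).indicator f1 t + (β + Real.log π) * ‖H t‖ ^ 2 :=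
    hint_ind.add hint_f2
  have hmono := integral_mono hint_rhs hint_w hpt
  rw [integral_add hint_ind hint_f2, integral_const_mul, integral_indicator measurableSet_Icc] at hmono
  -- evaluate
  have hP : ∫ t : ℝ, ‖H t‖ ^ 2 = 2 * π * n2 := by
    simp only [hH]
    rw [integral_norm_sq_weilMellin_half_line hg]
  have hI : ∫ t in Icc (-T) T, f1 t = ∫ t in (-T)..T, f1 t := by
    rw [intervalIntegral.integral_of_le (by linarith), integral_Icc_eq_integral_Ioc]
  rw [hP, hI] at hmono
  -- hmono : ∫_{-T}^{T} f1 + (β + log π)(2π n2) ≤ ∫ |H|² w_N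
  have key : 1 / (2 * π) * ((∫ t in (-T)..T, f1 t) + (β + Real.log π) * (2 * π * n2)) ≤
      1 / (2 * π) * ∫ t : ℝ, ‖H t‖ ^ 2 * weilFinitePrimeWeight N t :=
    mul_le_mul_of_nonneg_left hmono (by positivity)
  have e : 1 / (2 * π) * ((∫ t in (-T)..T, f1 t) + (β + Real.log π) * (2 * π * n2)) =
      1 / (2 * π) * (∫ t in (-T)..T, f1 t) + (β + Real.log π) * n2 := by
    field_simp
  rw [e] at key
  rw [hE]
  simp only [hf1, hH] at key ⊢
  linarith

/-- Evenness of the transform: `ĝ(1 − s) = ĝ(s)` for an even `g` (substitute `t ↦ −t`); in particular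
`ĝ(1) = ĝ(0)` and `ĝ(½ − it) = ĝ(½ + it)`. (The same statement is proved Summits-side as
`Summit.RiemannHypothesis.RiemannHypothesis.Theorems.RuelleBandExactFirstBand.weilMellin_one_sub_of_even`, which a
Literature file cannot import; cf. `weilMellin_comp_neg` of `WeilMellinInversion.lean`.)
[cite: Bombieri2000Weil, §2 (even functions f = f*)] -/
theorem weilMellin_one_sub_of_even {g : ℝ → ℂ} (hev : ∀ t : ℝ, g (-t) = g t) (s : ℂ) :
    weilMellin g (1 - s) = weilMellin g s := by
  unfold weilMellin
  have h := integral_neg_eq_self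
    (fun t : ℝ ↦ g (-t) * cexp ((1 - s - 1 / 2) * ((-t : ℝ) : ℂ))) volume
  simp only [neg_neg] at h
  rw [h]
  congr 1 with t
  rw [hev t]
  congr 1
  push_cast
  ring

/-- **Thm 7 (One-stroke reduction), inequality (6), as printed** — «for every real even `f` with
`supp f ⊆ [−L, L]`, `Q(f) ≥ R(f) := 2F(i/2)² + (1/π)∫₀^{T♯}(Ψ_L(t) − β*)|F(t)|² dt + β*‖f‖₂²`» whenever
`β* = log(T♯/2π) − 1/T♯ − A_L > 0` — here for every EVEN test function `g` of the window (for even `g`,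
`F(i/2) = ĝ(0) = ĝ(1)` and `|F|²` is even, so `2F(i/2)²` is `2‖ĝ(0)‖²` and the symmetric integral of
`weilQuadratic_re_ge_oneStroke` folds onto `[0, T♯]`; for real `f`, `ĝ(0) ∈ ℝ` and `‖ĝ(0)‖² = F(i/2)²`). The matrix/Legendre
part of Thm 7 is not typed (module note of this section). RH-FREE. [cite: Chuk2026WeilWindows, Thm 7 (eq. (6))] -/
theorem Chuk2026_thm7 {g : ℝ → ℂ} (hg : IsWeilTest g) {L T : ℝ} (hsupp : tsupport g ⊆ Icc (-L) L)
    (hev : ∀ t : ℝ, g (-t) = g t) (hT : 0 < T) (hβ : 0 < weilEnvelopeLevel L T) :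
    2 * ‖weilMellin g 0‖ ^ 2
      + 1 / π * (∫ t in (0 : ℝ)..T,
          (weilWindowSymbol L t - weilEnvelopeLevel L T) * ‖weilMellin g (1 / 2 + t * I)‖ ^ 2)
      + weilEnvelopeLevel L T * weilNorm2Sq g ≤ (weilQuadratic g).re := by
  have h := weilQuadratic_re_ge_oneStroke hg hsupp hT hβ
  -- polar term: `ĝ(1) = ĝ(0)`, `Re(z conj z) = ‖z‖²`
  have h1 : weilMellin g 1 = weilMellin g 0 := by
    rw [← weilMellin_one_sub_of_even hev 1, sub_self]
  have hpol : (weilMellin g 0 * conj (weilMellin g 1)).re = ‖weilMellin g 0‖ ^ 2 := by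
    rw [h1, Complex.mul_conj, Complex.ofReal_re, Complex.normSq_eq_norm_sq]
  -- the integrand is even
  set f1 : ℝ → ℝ := fun t ↦ (weilWindowSymbol L t - weilEnvelopeLevel L T) * ‖weilMellin g (1 / 2 + t * I)‖ ^ 2
    with hf1
  have hf1_even : ∀ t, f1 (-t) = f1 t := by
    intro t
    simp only [hf1]
    have hm : weilMellin g (1 / 2 + ((-t : ℝ) : ℂ) * I) = weilMellin g (1 / 2 + t * I) := by
      rw [← weilMellin_one_sub_of_even hev (1 / 2 + t * I)]
      congr 1
      push_cast
      ring
    rw [hm, ← weilWindowSymbol_abs L (-t), abs_neg, weilWindowSymbol_abs]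
  -- integrability on intervals
  have hint_H : Integrable fun t : ℝ ↦ ‖weilMellin g (1 / 2 + t * I)‖ ^ 2 :=
    integrable_norm_sq_weilMellin_half_line hg
  have hint_w := integrable_norm_sq_weilMellin_mul_weilFinitePrimeWeight hg (weilWindowCutoff L)
  have hint_f1 : Integrable f1 := by
    have h' := (hint_w.sub (hint_H.mul_const (Real.log π + weilEnvelopeLevel L T)))
    refine h'.congr (Eventually.of_forall fun t ↦ ?_)
    simp only [Pi.sub_apply, hf1, weilWindowSymbol]
    ring
  have hfold : ∫ t in (-T)..T, f1 t = 2 * ∫ t in (0 : ℝ)..T, f1 t := by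
    have hneg : ∫ t in (-T)..0, f1 t = ∫ t in (0 : ℝ)..T, f1 t := by
      have h' := intervalIntegral.integral_comp_neg (a := 0) (b := T) f1
      simp only [neg_zero] at h'
      rw [← h']
      exact intervalIntegral.integral_congr fun t _ ↦ hf1_even t
    rw [← intervalIntegral.integral_add_adjacent_intervals (b := 0)
      (hint_f1.intervalIntegrable) (hint_f1.intervalIntegrable), hneg]
    ring
  have hπ := Real.pi_pos
  have e : 1 / (2 * π) * (2 * ∫ t in (0 : ℝ)..T, f1 t) = 1 / π * ∫ t in (0 : ℝ)..T, f1 t := by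
    field_simp
  simp only [hf1] at hfold e
  rw [hpol, hfold, e] at h
  exact h

end Literature.NumberTheory.LFunctions

end
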